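import Summits.QuantumFields.GaugeBoot.StrongCouplingPlaquetteSU2
import Summits.QuantumFields.GaugeBoot.EquipartitionBoundLimit
import HarnessLib

/-!
# Strong coupling from the loop equation, VII: the bounds at every infinite-volume limit point (gauge-boot, ADDENDUM 22 part G)

HONEST FRAMING (cell `pub-gaugeboot`, page 1 of every file): the venture produces certified bounds
on lattice expectations at stated coupling, gauge group, dimension and torus size; NOT a mass gap,
NOT a continuum limit, NOT a string tension; NOT Yang–Mills-summit-bearing (barriers
`FixedCouplingUltralocality`, `PerturbativeInvisibility`).  Analytic STRONG-COUPLING bounds, uniform in the volume, hence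
valid at every thermodynamic limit point; informative only for small `β_std`; no uniqueness of the limit is claimed or used;
no number of CERTIFIED.md is touched.

## Content (`SU(N)`, fundamental representation, `D ≥ 2`, tree coupling `β_std/N`)

The torus bounds of `StrongCouplingOneStep` (first order, `N ≥ 2`, every real `β_std`), `StrongCouplingPlaquetteSUN`
(second order, `N ≥ 3`) and `StrongCouplingPlaquetteSU2` hold for EVERY torus side `L ≥ 2`, so they pass to every
`μ ∈ infiniteVolumeLimitPoints (suRep N) (β_std/N)` (weak limits of bounded continuous cylinder observables; the single
plaquette has the expectation of the mean plaquette on every torus):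

* `abs_integral_plaquette_sub_le_of_forall` — the transfer lemma: a uniform-in-`L` window for `plaquetteExpectation`
  is a window for `∫ (1/N) Re tr U_P dμ` at every limit point and every plaquette of `ℤ^D`;
* ★★★ `abs_integral_plaquette_le_of_mem_limitPoints` — `|∫ (1/N)Re tr U_P dμ| ≤ 4(D−1)|β_std|/(N²−1)` (`N ≥ 2`, every real
  `β_std`, every limit point, every plaquette);
* ★★★ `abs_integral_plaquette_sub_le_of_mem_limitPoints` — `N ≥ 3`:
  `|∫ (1/N)Re tr U_P dμ − β_std/(2N²)| ≤ C(N,D)·β_std²`, `C(N,D)` of `StrongCouplingPlaquetteSUN`; `SU(3)`, `D = 4`: `79β²/30`;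
* ★★★ `abs_integral_plaquette_sub_le_of_mem_limitPoints_two` — `SU(2)`: `|∫ ½Re tr U_P dμ − β_std/4| ≤ ((D−1)(16D−21)/9)·β_std²`.

With the Dobrushin–Shen–Zhu–Zhu uniqueness window of the tree (`6(d−1)N|β| < 1`) these are statements about THE infinite-volume
state; outside it, about every limit point.  References: as in parts A–F.  Everything is `[folklore]`.
-/

noncomputable section

open MeasureTheory Filter Topology
open Literature.MathematicalPhysics.QuantumFieldTheory
open Literature.MathematicalPhysics.QuantumLattice (LGConfig plaquetteObs plaquetteHolonomyZd IsCylinder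
  IsInfiniteVolumeLimitAlong infiniteVolumeLimitPoints fundamentalRep_apply)
open Literature.RepresentationTheory.CompactGroups

namespace Summit.QuantumFields.GaugeBoot

namespace StrongCoupling

/-- **Transfer lemma.**  If `|plaquetteExpectation N D L β_std − c| ≤ K` for every torus side `L ≥ 2`, then for every
`μ ∈ infiniteVolumeLimitPoints (suRep N) (β_std/N)` and every plaquette `(x; i ≠ j)` of `ℤ^D`:
`|∫ (1/N) Re tr U_P dμ − c| ≤ K` (weak convergence of the single-plaquette cylinder observable along the subsequence,
and `⟨u_P⟩_L = ⟨ū_P⟩_L` on every torus). [folklore] -/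
theorem abs_integral_plaquette_sub_le_of_forall {N D : ℕ} (hN : 1 ≤ N) {β c K : ℝ}
    (hK : ∀ (L : ℕ) [NeZero L], 2 ≤ L → |plaquetteExpectation N D L β - c| ≤ K)
    {μ : Measure (LGConfig D (SU N))} (hμ : μ ∈ infiniteVolumeLimitPoints (d := D) (suRep N) (β / N))
    (x : Literature.Probability.LatticeModels.Site D) {i j : Fin D} (hij : i ≠ j) :
    |∫ U, (N : ℝ)⁻¹ * plaquetteObs (suRep N) x i j U ∂μ - c| ≤ K := by
  obtain ⟨Lk, hmono, hlim⟩ := hμ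
  have hN0 : N ≠ 0 := by omega
  have hNpos : (0 : ℝ) < N := by exact_mod_cast Nat.pos_of_ne_zero hN0
  set F : LGConfig D (SU N) → ℝ := fun U => (N : ℝ)⁻¹ * plaquetteObs (suRep N) x i j U with hF
  have hcyl : IsCylinder F ({(x, i), (x + Pi.single i 1, j), (x + Pi.single j 1, i), (x, j)} :
      Finset (Literature.MathematicalPhysics.QuantumLattice.ZdEdge D)) := by
    intro U V hUV
    simp only [hF, plaquetteObs, plaquetteHolonomyZd]
    rw [hUV (x, i) (by simp), hUV (x + Pi.single i 1, j) (by simp), hUV (x + Pi.single j 1, i) (by simp),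
      hUV (x, j) (by simp)]
  have hcont : Continuous F := by
    have h1 : Continuous fun U : LGConfig D (SU N) => plaquetteHolonomyZd U x i j := by
      unfold plaquetteHolonomyZd; fun_prop
    exact continuous_const.mul ((continuous_trace_re (suRep N) (continuous_suRep N)).comp h1)
  have hbd : ∃ C, ∀ U, |F U| ≤ C := by
    refine ⟨1, fun U => ?_⟩
    have h := CompactGroup.abs_re_trace_le_card (suRep N) (continuous_suRep N) (plaquetteHolonomyZd U x i j)
    rw [Fintype.card_fin] at h
    simp only [hF, plaquetteObs]
    rw [abs_mul, abs_inv, Nat.abs_cast]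
    calc (N : ℝ)⁻¹ * |((suRep N) (plaquetteHolonomyZd U x i j)).trace.re| ≤ (N : ℝ)⁻¹ * N := by gcongr
      _ = 1 := inv_mul_cancel₀ hNpos.ne'
  have htend := hlim.2 F _ hcyl hcont hbd
  have hFt : ∀ L : ℕ, Literature.MathematicalPhysics.QuantumLattice.toTorusObservable L F =
      plaquetteTrace (suRep N) (Literature.Probability.LatticeModels.Torus.proj L x) i j := fun L =>
    toTorusObservable_plaquetteObs (suRep N) L x i j
  simp only [hFt] at htend
  have hev : ∀ᶠ k in atTop,
      wilsonExpectation (suRep N) (β / N)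
        (plaquetteTrace (suRep N) (Literature.Probability.LatticeModels.Torus.proj (Lk k + 1) x) i j) ∈
      Set.Icc (c - K) (c + K) := by
    refine Filter.eventually_atTop.2 ⟨1, fun k hk => ?_⟩
    have hL : 2 ≤ Lk k + 1 := Nat.succ_le_succ (hk.trans (hmono.id_le k))
    have h := hK (Lk k + 1) hL
    unfold plaquetteExpectation at h
    rw [wilsonExpectation_meanPlaquette_eq_plaquetteTrace (suRep N) (continuous_suRep N) (β / N)
      (Literature.Probability.LatticeModels.Torus.proj (Lk k + 1) x) hij] at h
    rw [abs_sub_le_iff] at h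
    exact ⟨by linarith [h.2], by linarith [h.1]⟩
  have hmem := isClosed_Icc.mem_of_tendsto htend hev
  rw [abs_sub_le_iff]
  exact ⟨by linarith [hmem.2], by linarith [hmem.1]⟩

/-- ★★★ **First order at every infinite-volume limit point** (`SU(N)`, `N ≥ 2`, `D ≥ 2`, EVERY real `β_std`): for every
`μ ∈ infiniteVolumeLimitPoints (suRep N) (β_std/N)` and every plaquette of `ℤ^D`,
`|∫ (1/N) Re tr U_P dμ| ≤ 4(D−1)|β_std|/(N²−1)`. [folklore] -/
theorem abs_integral_plaquette_le_of_mem_limitPoints {N D : ℕ} (hN : 2 ≤ N) (hD : 2 ≤ D) (β : ℝ)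
    {μ : Measure (LGConfig D (SU N))} (hμ : μ ∈ infiniteVolumeLimitPoints (d := D) (suRep N) (β / N))
    (x : Literature.Probability.LatticeModels.Site D) {i j : Fin D} (hij : i ≠ j) :
    |∫ U, (N : ℝ)⁻¹ * plaquetteObs (suRep N) x i j U ∂μ| ≤ 4 * ((D : ℝ) - 1) * |β| / ((N : ℝ) ^ 2 - 1) := by
  have h := abs_integral_plaquette_sub_le_of_forall (c := 0) (by omega : 1 ≤ N)
    (fun L _ hL => by rw [sub_zero]; exact abs_plaquetteExpectation_le hN hL hD β) hμ x hij
  rwa [sub_zero] at h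

/-- ★★★ **Second order at every infinite-volume limit point, `N ≥ 3`**: for `D ≥ 2`, every real `β_std`, every
`μ ∈ infiniteVolumeLimitPoints (suRep N) (β_std/N)` and every plaquette of `ℤ^D`,
`|∫ (1/N) Re tr U_P dμ − β_std/(2N²)| ≤ (2(D−1)β_std²/(N²(N²−1)))·(1 + 4N⁴/((N²−1)(N²−4)) + 4(2D−3)N²/(N²−1))`.
[folklore] -/
theorem abs_integral_plaquette_sub_le_of_mem_limitPoints {N D : ℕ} (hN : 3 ≤ N) (hD : 2 ≤ D) (β : ℝ)
    {μ : Measure (LGConfig D (SU N))} (hμ : μ ∈ infiniteVolumeLimitPoints (d := D) (suRep N) (β / N))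
    (x : Literature.Probability.LatticeModels.Site D) {i j : Fin D} (hij : i ≠ j) :
    |∫ U, (N : ℝ)⁻¹ * plaquetteObs (suRep N) x i j U ∂μ - β / (2 * (N : ℝ) ^ 2)| ≤
      2 * ((D : ℝ) - 1) * β ^ 2 / ((N : ℝ) ^ 2 * ((N : ℝ) ^ 2 - 1)) *
        (1 + 4 * (N : ℝ) ^ 4 / (((N : ℝ) ^ 2 - 1) * ((N : ℝ) ^ 2 - 4)) + 4 * (2 * (D : ℝ) - 3) * (N : ℝ) ^ 2 / ((N : ℝ) ^ 2 - 1)) :=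
  abs_integral_plaquette_sub_le_of_forall (by omega : 1 ≤ N) (fun L _ hL => abs_plaquetteExpectation_sub_le hN hL hD β) hμ x
    hij

/-- `SU(3)`, `D = 4`, at every infinite-volume limit point: `|∫ ⅓Re tr U_P dμ − β_std/18| ≤ 79β_std²/30`. [folklore] -/
theorem abs_integral_plaquette_sub_le_of_mem_limitPoints_three_four (β : ℝ) {μ : Measure (LGConfig 4 (SU 3))}
    (hμ : μ ∈ infiniteVolumeLimitPoints (d := 4) (suRep 3) (β / 3)) (x : Literature.Probability.LatticeModels.Site 4)
    {i j : Fin 4} (hij : i ≠ j) :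
    |∫ U, (3 : ℝ)⁻¹ * plaquetteObs (suRep 3) x i j U ∂μ - β / 18| ≤ 79 * β ^ 2 / 30 := by
  have h := abs_integral_plaquette_sub_le_of_forall (N := 3) (D := 4) (c := β / 18) (K := 79 * β ^ 2 / 30) (by norm_num)
    (fun L _ hL => abs_plaquetteExpectation_three_four_sub_le hL β) (by simpa using hμ) x hij
  simpa using h

/-- ★★★ **Second order at every infinite-volume limit point, `SU(2)`**: for `D ≥ 2`, every real `β_std`, every
`μ ∈ infiniteVolumeLimitPoints (suRep 2) (β_std/2)` and every plaquette of `ℤ^D`,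
`|∫ ½Re tr U_P dμ − β_std/4| ≤ ((D−1)(16D−21)/9)·β_std²`. [folklore] -/
theorem abs_integral_plaquette_sub_le_of_mem_limitPoints_two {D : ℕ} (hD : 2 ≤ D) (β : ℝ)
    {μ : Measure (LGConfig D (SU 2))} (hμ : μ ∈ infiniteVolumeLimitPoints (d := D) (suRep 2) (β / 2))
    (x : Literature.Probability.LatticeModels.Site D) {i j : Fin D} (hij : i ≠ j) :
    |∫ U, (2 : ℝ)⁻¹ * plaquetteObs (suRep 2) x i j U ∂μ - β / 4| ≤ ((D : ℝ) - 1) * (16 * (D : ℝ) - 21) / 9 * β ^ 2 := by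
  have h := abs_integral_plaquette_sub_le_of_forall (N := 2) (D := D) (c := β / 4)
    (K := ((D : ℝ) - 1) * (16 * (D : ℝ) - 21) / 9 * β ^ 2) (by norm_num)
    (fun L _ hL => abs_plaquetteExpectation_two_sub_le hL hD β) (by simpa using hμ) x hij
  simpa using h

/-! ## The cell's target shape (A) at strong coupling: analytic two-sided windows for all tori -/

/-- ★★ **Analytic strong-coupling window, shape (A), `SU(N)`, `N ≥ 3`**: for `D ≥ 2`, every `L₀ ≥ 2` and every real `β_std`,
`PlaquetteWindow N D L₀ β_std (β_std/(2N²) − C(N,D)β_std²) (β_std/(2N²) + C(N,D)β_std²)` — a certified two-sided bound on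
`⟨ū_P⟩` for EVERY torus of side `≥ L₀`, informative for `β_std ≲ 10⁻²` (where no SDP certificate of the cell lives).
[folklore] -/
theorem plaquetteWindow_strongCoupling {N D L₀ : ℕ} (hN : 3 ≤ N) (hD : 2 ≤ D) (hL₀ : 2 ≤ L₀) (β : ℝ) :
    PlaquetteWindow N D L₀ β
      (β / (2 * (N : ℝ) ^ 2) - 2 * ((D : ℝ) - 1) * β ^ 2 / ((N : ℝ) ^ 2 * ((N : ℝ) ^ 2 - 1)) *
        (1 + 4 * (N : ℝ) ^ 4 / (((N : ℝ) ^ 2 - 1) * ((N : ℝ) ^ 2 - 4)) + 4 * (2 * (D : ℝ) - 3) * (N : ℝ) ^ 2 / ((N : ℝ) ^ 2 - 1)))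
      (β / (2 * (N : ℝ) ^ 2) + 2 * ((D : ℝ) - 1) * β ^ 2 / ((N : ℝ) ^ 2 * ((N : ℝ) ^ 2 - 1)) *
        (1 + 4 * (N : ℝ) ^ 4 / (((N : ℝ) ^ 2 - 1) * ((N : ℝ) ^ 2 - 4)) + 4 * (2 * (D : ℝ) - 3) * (N : ℝ) ^ 2 / ((N : ℝ) ^ 2 - 1))) := by
  intro L _ _ hL
  have h := abs_plaquetteExpectation_sub_le (N := N) (D := D) (L := L) hN (hL₀.trans hL) hD β
  rw [abs_sub_le_iff] at h
  constructor <;> linarith [h.1, h.2]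

/-- `T4` (`SU(3)`, `D = 4`), shape (A): `PlaquetteWindow 3 4 L₀ β (β/18 − 79β²/30) (β/18 + 79β²/30)` for every `L₀ ≥ 2` and
every real `β` — e.g. `β_std = 1/100`: `⟨ū_P⟩ ∈ [1/1800 − 79/300000, 1/1800 + 79/300000]` on every torus. [folklore] -/
theorem plaquetteWindow_strongCoupling_three_four {L₀ : ℕ} (hL₀ : 2 ≤ L₀) (β : ℝ) :
    PlaquetteWindow 3 4 L₀ β (β / 18 - 79 * β ^ 2 / 30) (β / 18 + 79 * β ^ 2 / 30) := by
  intro L _ _ hL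
  have h := abs_plaquetteExpectation_three_four_sub_le (L := L) (hL₀.trans hL) β
  rw [abs_sub_le_iff] at h
  constructor <;> linarith [h.1, h.2]

/-- ★★ **Analytic strong-coupling window, shape (A), `SU(2)`**: `PlaquetteWindow 2 D L₀ β (β/4 − Kβ²) (β/4 + Kβ²)`,
`K = (D−1)(16D−21)/9`, for every `L₀ ≥ 2` and every real `β`. [folklore] -/
theorem plaquetteWindow_strongCoupling_two {D L₀ : ℕ} (hD : 2 ≤ D) (hL₀ : 2 ≤ L₀) (β : ℝ) :
    PlaquetteWindow 2 D L₀ β (β / 4 - ((D : ℝ) - 1) * (16 * (D : ℝ) - 21) / 9 * β ^ 2)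
      (β / 4 + ((D : ℝ) - 1) * (16 * (D : ℝ) - 21) / 9 * β ^ 2) := by
  intro L _ _ hL
  have h := abs_plaquetteExpectation_two_sub_le (D := D) (L := L) (hL₀.trans hL) hD β
  rw [abs_sub_le_iff] at h
  constructor <;> linarith [h.1, h.2]

end StrongCoupling

end Summit.QuantumFields.GaugeBoot

end
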